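import Literature.Geometry.Kaehler.AnalyticSetProduct
import Literature.Geometry.Kaehler.ComplexTorusIsogenies
import Literature.Geometry.Kaehler.ComplexTorusRiemannFormTransport
import Mathlib.Analysis.InnerProductSpace.ProdL2
import Mathlib.Analysis.Normed.Lp.MeasurableSpace
import HarnessLib

/-!
# The Euclidean (`L²`) presentation of the product of two complex tori

Layer `Literature/Geometry/Kaehler`, namespace `Literature.Geometry.Kaehler.ComplexTorus` (lane
`lit-hodgefound`, Track 2 foundations, Layer A2/A4). The tree presents the product of the complex tori
`X₁ = E₁/Φ₁(ℤ^ι₁)`, `X₂ = E₂/Φ₂(ℤ^ι₂)` by the period isomorphism `prodPeriod Φ₁ Φ₂ : ℝ^(ι₁ ⊔ ι₂) ≃ E₁ × E₂`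
(`ComplexTorusProduct.lean`), the model vector space `E₁ × E₂` carrying Mathlib's `sup` norm. The
analytic cycle classes of Layer A4 (`ComplexTorus.analyticCyclePeriod`, `analyticCycleClass`: the current
of integration `ω ↦ ∫_{reg Z} ω` built from the Hausdorff measure `𝓗^{2d}`) require an
**inner product space** as model (`[InnerProductSpace ℂ E]`), which `E₁ × E₂` is not; Mathlib's
Euclidean product is the type synonym `WithLp 2 (E₁ × E₂)` (`Mathlib.Analysis.InnerProductSpace.ProdL2`).
This file provides the **Euclidean presentation of the product torus**,
`prodPeriodL2 Φ₁ Φ₂ : ℝ^(ι₁ ⊔ ι₂) ≃ WithLp 2 (E₁ × E₂)`, and identifies it with the `sup` presentation by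
the degree-one isogenies of the identity matrix (a mere change of presentation: the underlying group
`(ℝ/ℤ)^(ι₁ ⊔ ι₂)` is the same), so that

* every presentation-covariant construction of the tree (pull-back of invariant forms A1-21, Riemann
  forms, abelian-variety structure, analytic subsets and their pure dimension) transfers by name along
  `IsIsogeny (prodPeriod Φ₁ Φ₂) (prodPeriodL2 Φ₁ Φ₂) 1` / `IsIsogeny (prodPeriodL2 Φ₁ Φ₂) (prodPeriod Φ₁ Φ₂) 1`;
* the product `Z₁ × Z₂` of analytic subsets of pure dimensions `d₁`, `d₂` is an analytic subset of pure
  dimension `d₁ + d₂` of the Euclidean product torus (`hasPureDim_preimage_prodHomeomorphL2_prod`), whose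
  **analytic cycle class `[Z₁ × Z₂] ∈ H^{2(g₁+g₂-d₁-d₂)}(X₁ × X₂)` is therefore defined** (A4's
  `analyticCycleClass (prodPeriodL2 Φ₁ Φ₂)`; validation `analyticCyclePeriod_prodL2_eq_zero_of_isOfTypeAt`);
* a pair of polarisations polarises the Euclidean product (`IsRiemannForm.prodL2`, `IsAbelianVariety.prodL2`).

Sources: H. Lange, *Abelian Varieties over the Complex Numbers* (2023), §1.1 (complex tori `V/Λ`, products),
§2.4 Cor. 2.4.24 / Birkenhake–Lange (1992) §5.3 (product polarisations); the inner product on `V₁ ⊕ V₂` is the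
orthogonal sum (Mathlib `WithLp.instProdInnerProductSpace`). E. M. Chirka, *Complex Analytic Sets* (1989),
§2.1 item 4, §3.5 (products of analytic sets, `dim A₁ × A₂ = dim A₁ + dim A₂`).

## Contents (definitions with bodies and proved theorems; no named fact)

* §1 `prodPeriodL2` (`prodPeriodL2_apply`, `ofLp_prodPeriodL2`, `prodPeriodL2_symm_apply`, `prodPeriodL2_intVec`);
* §2 the change of presentation: `mapMatrix_one_eq` (the identity matrix acts as the identity between any two
  presentations on the same lattice coordinates), `mapMatrix_one_bijective`, `ker_mapMatrixHom_one`,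
  `natCard_ker_mapMatrixHom_one` (degree `1`), `isIsogeny_one_prodPeriod_prodPeriodL2`,
  `isIsogeny_one_prodPeriodL2_prodPeriod`, `realRep_one_prodPeriod_prodPeriodL2 = toLp`,
  `realRep_one_prodPeriodL2_prodPeriod = ofLp`, holomorphy `contMDiff_mapMatrix_one_prodPeriod_prodPeriodL2`,
  `contMDiff_mapMatrix_one_prodPeriodL2_prodPeriod`;
* §3 `prodHomeomorphL2 : ComplexTorus (prodPeriodL2 Φ₁ Φ₂) ≃ₜ ComplexTorus Φ₁ × ComplexTorus Φ₂`
  (`_apply`, `_add`, `_proj`, `_proj_symm`), a biholomorphism (`contMDiff_prodHomeomorphL2`,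
  `contMDiff_prodHomeomorphL2_symm`, `mdifferentiable_prodHomeomorphL2(_symm)`);
* §4 `isAnalyticSet_preimage_prodHomeomorphL2_prod`, **`hasPureDim_preimage_prodHomeomorphL2_prod`**
  (+ `…_prod_univ`, `…_univ_prod`, `…_prod_singleton`, `…_singleton_prod`);
* §5 `IsRiemannForm.prodL2`, `IsAbelianVariety.prodL2`;
* §6 validation: `analyticCyclePeriod_prodL2_eq_zero_of_isOfTypeAt` (A4's current of integration of
  `Z₁ × Z₂` on the Euclidean product torus has bidimension `(d₁+d₂, d₁+d₂)`).

## References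

* [Lange2023AbelianVarietiesComplex] H. Lange, *Abelian Varieties over the Complex Numbers* (2023), §1.1,
  §2.1.1 Prop. 2.1.1, §2.4 Cor. 2.4.24.
* [LangeBirkenhake1992] H. Lange, Ch. Birkenhake, *Complex Abelian Varieties* (1992), §1.1, §5.3.
* [Chirka1989] E. M. Chirka, *Complex Analytic Sets* (1989), §2.1 item 4, §3.5, §14.1.
* [VoisinHodgeI2002] C. Voisin, *Hodge Theory and Complex Algebraic Geometry I* (2002), §11.1.2–11.1.3.
-/

noncomputable section

open scoped Manifold ContDiff Topology
open Set Function Module WithLp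
open Literature.Analysis.Complex (IsOfTypeAt)

namespace Literature.Geometry.Kaehler

namespace ComplexTorus

variable {ι₁ ι₂ : Type*} [Fintype ι₁] [Fintype ι₂] {E₁ E₂ : Type*} [NormedAddCommGroup E₁]
  [NormedSpace ℂ E₁] [NormedAddCommGroup E₂] [NormedSpace ℂ E₂]
  (Φ₁ : (ι₁ → ℝ) ≃L[ℝ] E₁) (Φ₂ : (ι₂ → ℝ) ≃L[ℝ] E₂)

/-! ### §1 The Euclidean period isomorphism of the product -/

/-- **The Euclidean presentation of the product torus**: the period isomorphism
`ℝ^(ι₁ ⊔ ι₂) ≃ WithLp 2 (E₁ × E₂)`, `v ↦ (Φ₁(v|ι₁), Φ₂(v|ι₂))` read in the `L²`-product (an inner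
product space when `E₁`, `E₂` are), i.e. `prodPeriod Φ₁ Φ₂` followed by `toLp 2`.
[cite: LangeBirkenhake1992, §5.3 (products of complex tori / polarized abelian varieties)] -/
def prodPeriodL2 : (ι₁ ⊕ ι₂ → ℝ) ≃L[ℝ] WithLp 2 (E₁ × E₂) :=
  (prodPeriod Φ₁ Φ₂).trans (WithLp.prodContinuousLinearEquiv 2 ℝ E₁ E₂).symm

/-- `prodPeriodL2 Φ₁ Φ₂ v = toLp 2 (prodPeriod Φ₁ Φ₂ v)`. [cite: LangeBirkenhake1992, §5.3] -/
@[simp] theorem prodPeriodL2_apply (v : ι₁ ⊕ ι₂ → ℝ) :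
    prodPeriodL2 Φ₁ Φ₂ v = toLp 2 (prodPeriod Φ₁ Φ₂ v) := rfl

/-- `ofLp (prodPeriodL2 Φ₁ Φ₂ v) = prodPeriod Φ₁ Φ₂ v`. [cite: LangeBirkenhake1992, §5.3] -/
theorem ofLp_prodPeriodL2 (v : ι₁ ⊕ ι₂ → ℝ) : ofLp (prodPeriodL2 Φ₁ Φ₂ v) = prodPeriod Φ₁ Φ₂ v := rfl

/-- `(prodPeriodL2 Φ₁ Φ₂)⁻¹ z = (prodPeriod Φ₁ Φ₂)⁻¹ (ofLp z)`. [cite: LangeBirkenhake1992, §5.3] -/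
theorem prodPeriodL2_symm_apply (z : WithLp 2 (E₁ × E₂)) :
    (prodPeriodL2 Φ₁ Φ₂).symm z = (prodPeriod Φ₁ Φ₂).symm (ofLp z) := rfl

/-- Lattice vectors of the Euclidean product are pairs of lattice vectors.
[cite: LangeBirkenhake1992, §5.3] -/
theorem prodPeriodL2_intVec (m : ι₁ ⊕ ι₂ → ℤ) :
    prodPeriodL2 Φ₁ Φ₂ (intVec m) =
      toLp 2 (Φ₁ (intVec fun i ↦ m (Sum.inl i)), Φ₂ (intVec fun j ↦ m (Sum.inr j))) := rfl

/-! ### §2 The change of presentation `E₁ × E₂ ↔ WithLp 2 (E₁ × E₂)`: degree-one isogenies -/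

section ChangeOfPresentation

variable {ι : Type*} [Fintype ι] [DecidableEq ι] {E E' : Type*} [NormedAddCommGroup E] [NormedSpace ℂ E]
  [NormedAddCommGroup E'] [NormedSpace ℂ E'] (Φ : (ι → ℝ) ≃L[ℝ] E) (Φ' : (ι → ℝ) ≃L[ℝ] E')

/-- **The identity matrix acts as the identity between any two presentations with the same lattice
coordinates**: `mapMatrix Φ Φ' 1 x = x` on `(ℝ/ℤ)^ι` (the map only depends on the matrix).
[cite: LangeBirkenhake1992, §1.1.2] -/
theorem mapMatrix_one_eq (x : ComplexTorus Φ) : mapMatrix Φ Φ' (1 : Matrix ι ι ℤ) x = x := by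
  funext i
  rw [mapMatrix_apply, Finset.sum_eq_single i (fun j _ hj ↦ by rw [Matrix.one_apply_ne' hj, zero_smul])
    (fun hi ↦ absurd (Finset.mem_univ i) hi), Matrix.one_apply_eq, one_smul]

/-- The change of presentation `ρ(1) : E/Φ(ℤ^ι) → E'/Φ'(ℤ^ι)` is bijective. [cite: LangeBirkenhake1992, §1.1.2] -/
theorem mapMatrix_one_bijective : Function.Bijective (mapMatrix Φ Φ' (1 : Matrix ι ι ℤ)) :=
  ⟨fun x y h ↦ by rwa [mapMatrix_one_eq, mapMatrix_one_eq] at h, fun y ↦ ⟨y, mapMatrix_one_eq Φ Φ' y⟩⟩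

/-- The change of presentation `ρ(1)` has trivial kernel. [cite: LangeBirkenhake1992, §1.1.2] -/
theorem ker_mapMatrixHom_one : (mapMatrixHom Φ Φ' (1 : Matrix ι ι ℤ)).ker = ⊥ :=
  (AddMonoidHom.ker_eq_bot_iff _).2 (mapMatrix_one_bijective Φ Φ').1

/-- … so its degree `#Ker ρ(1)` is `1`. [cite: LangeBirkenhake1992, §1.1.2] -/
theorem natCard_ker_mapMatrixHom_one : Nat.card (mapMatrixHom Φ Φ' (1 : Matrix ι ι ℤ)).ker = 1 := by
  rw [ker_mapMatrixHom_one, AddSubgroup.card_bot]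

/-- `(1 : Matrix ι ι ℤ)_ℝ x = x`. [folklore] -/
private theorem one_map_intCast_mulVec (x : ι → ℝ) :
    ((1 : Matrix ι ι ℤ).map (Int.cast : ℤ → ℝ)).mulVec x = x := by
  rw [Matrix.map_one Int.cast Int.cast_zero Int.cast_one, Matrix.one_mulVec]

end ChangeOfPresentation

section Isogeny

variable [DecidableEq ι₁] [DecidableEq ι₂]

/-- **The change of presentation `E₁ × E₂ → WithLp 2 (E₁ × E₂)` is an isogeny** (of the identity
matrix, with invertible `ℂ`-linear analytic representation `toLp 2`; Lemma 1.1.11 (iii) ⇒ (i)).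
[cite: Lange2023AbelianVarietiesComplex, §1.1.2 Lemma 1.1.11] -/
theorem isIsogeny_one_prodPeriod_prodPeriodL2 :
    IsIsogeny (prodPeriod Φ₁ Φ₂) (prodPeriodL2 Φ₁ Φ₂) (1 : Matrix (ι₁ ⊕ ι₂) (ι₁ ⊕ ι₂) ℤ) :=
  (isIsogeny_iff_exists_bijective (prodPeriod Φ₁ Φ₂) (prodPeriodL2 Φ₁ Φ₂) 1).2
    ⟨((WithLp.prodContinuousLinearEquiv 2 ℂ E₁ E₂).symm : (E₁ × E₂) →L[ℂ] WithLp 2 (E₁ × E₂)),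
      fun x ↦ by rw [one_map_intCast_mulVec]; rfl,
      (WithLp.prodContinuousLinearEquiv 2 ℂ E₁ E₂).symm.bijective⟩

/-- **The change of presentation `WithLp 2 (E₁ × E₂) → E₁ × E₂` is an isogeny** (identity matrix,
analytic representation `ofLp`). [cite: Lange2023AbelianVarietiesComplex, §1.1.2 Lemma 1.1.11] -/
theorem isIsogeny_one_prodPeriodL2_prodPeriod :
    IsIsogeny (prodPeriodL2 Φ₁ Φ₂) (prodPeriod Φ₁ Φ₂) (1 : Matrix (ι₁ ⊕ ι₂) (ι₁ ⊕ ι₂) ℤ) :=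
  (isIsogeny_iff_exists_bijective (prodPeriodL2 Φ₁ Φ₂) (prodPeriod Φ₁ Φ₂) 1).2
    ⟨(WithLp.prodContinuousLinearEquiv 2 ℂ E₁ E₂ : WithLp 2 (E₁ × E₂) →L[ℂ] (E₁ × E₂)),
      fun x ↦ by rw [one_map_intCast_mulVec]; rfl,
      (WithLp.prodContinuousLinearEquiv 2 ℂ E₁ E₂).bijective⟩

/-- The analytic (real) representation of the change of presentation `E₁ × E₂ → WithLp 2 (E₁ × E₂)` is
`toLp 2`. [cite: Lange2023AbelianVarietiesComplex, §1.1.2 (analytic representation)] -/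
theorem realRep_one_prodPeriod_prodPeriodL2 :
    realRep (prodPeriod Φ₁ Φ₂) (prodPeriodL2 Φ₁ Φ₂) (1 : Matrix (ι₁ ⊕ ι₂) (ι₁ ⊕ ι₂) ℤ) =
      ((WithLp.prodContinuousLinearEquiv 2 ℝ E₁ E₂).symm : (E₁ × E₂) →L[ℝ] WithLp 2 (E₁ × E₂)) := by
  refine ContinuousLinearMap.ext fun z ↦ ?_
  obtain ⟨x, rfl⟩ := (prodPeriod Φ₁ Φ₂).surjective z
  rw [realRep_apply, one_map_intCast_mulVec]
  rfl

/-- The analytic (real) representation of the change of presentation `WithLp 2 (E₁ × E₂) → E₁ × E₂` is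
`ofLp`. [cite: Lange2023AbelianVarietiesComplex, §1.1.2 (analytic representation)] -/
theorem realRep_one_prodPeriodL2_prodPeriod :
    realRep (prodPeriodL2 Φ₁ Φ₂) (prodPeriod Φ₁ Φ₂) (1 : Matrix (ι₁ ⊕ ι₂) (ι₁ ⊕ ι₂) ℤ) =
      (WithLp.prodContinuousLinearEquiv 2 ℝ E₁ E₂ : WithLp 2 (E₁ × E₂) →L[ℝ] (E₁ × E₂)) := by
  refine ContinuousLinearMap.ext fun z ↦ ?_
  obtain ⟨x, rfl⟩ := (prodPeriodL2 Φ₁ Φ₂).surjective z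
  rw [realRep_apply, one_map_intCast_mulVec]
  rfl

/-- The change of presentation `E₁ × E₂ → WithLp 2 (E₁ × E₂)` is holomorphic (models `𝓘(ℂ, E₁ × E₂)`,
`𝓘(ℂ, WithLp 2 (E₁ × E₂))`). [cite: LangeBirkenhake1992, §1.1.2] -/
theorem contMDiff_mapMatrix_one_prodPeriod_prodPeriodL2 {n : WithTop ℕ∞} :
    ContMDiff 𝓘(ℂ, E₁ × E₂) 𝓘(ℂ, WithLp 2 (E₁ × E₂)) n
      (mapMatrix (prodPeriod Φ₁ Φ₂) (prodPeriodL2 Φ₁ Φ₂) (1 : Matrix (ι₁ ⊕ ι₂) (ι₁ ⊕ ι₂) ℤ)) :=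
  contMDiff_mapMatrix ((WithLp.prodContinuousLinearEquiv 2 ℂ E₁ E₂).symm : (E₁ × E₂) →L[ℂ] _)
    fun x ↦ by rw [one_map_intCast_mulVec]; rfl

/-- The change of presentation `WithLp 2 (E₁ × E₂) → E₁ × E₂` is holomorphic. [cite: LangeBirkenhake1992, §1.1.2] -/
theorem contMDiff_mapMatrix_one_prodPeriodL2_prodPeriod {n : WithTop ℕ∞} :
    ContMDiff 𝓘(ℂ, WithLp 2 (E₁ × E₂)) 𝓘(ℂ, E₁ × E₂) n
      (mapMatrix (prodPeriodL2 Φ₁ Φ₂) (prodPeriod Φ₁ Φ₂) (1 : Matrix (ι₁ ⊕ ι₂) (ι₁ ⊕ ι₂) ℤ)) :=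
  contMDiff_mapMatrix (WithLp.prodContinuousLinearEquiv 2 ℂ E₁ E₂ : WithLp 2 (E₁ × E₂) →L[ℂ] _)
    fun x ↦ by rw [one_map_intCast_mulVec]; rfl

end Isogeny

/-! ### §3 The Euclidean product torus is biholomorphic to the product of the tori -/

/-- **The Euclidean product torus is the product**: the tautological additive homeomorphism
`WithLp 2 (E₁ × E₂)/(Λ₁ ⊕ Λ₂) ≃ₜ E₁/Λ₁ × E₂/Λ₂` (on lattice coordinates
`(ℝ/ℤ)^(ι₁ ⊔ ι₂) = (ℝ/ℤ)^ι₁ × (ℝ/ℤ)^ι₂`, the same map as `prodHomeomorph`). [cite: LangeBirkenhake1992, §5.3] -/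
def prodHomeomorphL2 : ComplexTorus (prodPeriodL2 Φ₁ Φ₂) ≃ₜ ComplexTorus Φ₁ × ComplexTorus Φ₂ :=
  Homeomorph.sumArrowHomeomorphProdArrow (ι := ι₁) (ι' := ι₂) (X := AddCircle (1 : ℝ))

/-- `prodHomeomorphL2 t = (t|ι₁, t|ι₂)`. [cite: LangeBirkenhake1992, §5.3] -/
theorem prodHomeomorphL2_apply (t : ComplexTorus (prodPeriodL2 Φ₁ Φ₂)) :
    prodHomeomorphL2 Φ₁ Φ₂ t = ((fun i ↦ t (Sum.inl i) : ComplexTorus Φ₁),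
      (fun j ↦ t (Sum.inr j) : ComplexTorus Φ₂)) := rfl

/-- The Euclidean product identification is additive. [cite: LangeBirkenhake1992, §5.3] -/
theorem prodHomeomorphL2_add (s t : ComplexTorus (prodPeriodL2 Φ₁ Φ₂)) :
    prodHomeomorphL2 Φ₁ Φ₂ (s + t) = prodHomeomorphL2 Φ₁ Φ₂ s + prodHomeomorphL2 Φ₁ Φ₂ t := rfl

/-- The Euclidean product identification commutes with the covering maps:
`prodHomeomorphL2 (proj v) = (proj (v|ι₁), proj (v|ι₂))`. [cite: LangeBirkenhake1992, §5.3] -/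
theorem prodHomeomorphL2_proj (v : ι₁ ⊕ ι₂ → ℝ) :
    prodHomeomorphL2 Φ₁ Φ₂ (proj (prodPeriodL2 Φ₁ Φ₂) v) =
      (proj Φ₁ (fun i ↦ v (Sum.inl i)), proj Φ₂ (fun j ↦ v (Sum.inr j))) := rfl

/-- `prodHomeomorphL2 (π z) = (π₁ z.1, π₂ z.2)` on the universal covers (`π = proj ∘ (prodPeriodL2)⁻¹`).
[cite: LangeBirkenhake1992, §5.3] -/
theorem prodHomeomorphL2_proj_symm (z : WithLp 2 (E₁ × E₂)) :
    prodHomeomorphL2 Φ₁ Φ₂ (proj (prodPeriodL2 Φ₁ Φ₂) ((prodPeriodL2 Φ₁ Φ₂).symm z)) =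
      (proj Φ₁ (Φ₁.symm (ofLp z).1), proj Φ₂ (Φ₂.symm (ofLp z).2)) := by
  rw [prodHomeomorphL2_proj, prodPeriodL2_symm_apply, prodPeriod_symm_inl, prodPeriod_symm_inr]

/-- The Euclidean product identification factors through the `sup` one and the change of presentation:
`prodHomeomorphL2 = prodHomeomorph ∘ ρ(1)`. [cite: LangeBirkenhake1992, §5.3] -/
theorem prodHomeomorphL2_eq_comp [DecidableEq ι₁] [DecidableEq ι₂] :
    (prodHomeomorphL2 Φ₁ Φ₂ : ComplexTorus (prodPeriodL2 Φ₁ Φ₂) → ComplexTorus Φ₁ × ComplexTorus Φ₂) =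
      prodHomeomorph Φ₁ Φ₂ ∘
        mapMatrix (prodPeriodL2 Φ₁ Φ₂) (prodPeriod Φ₁ Φ₂) (1 : Matrix (ι₁ ⊕ ι₂) (ι₁ ⊕ ι₂) ℤ) := by
  funext t
  rw [comp_apply, mapMatrix_one_eq]
  rfl

/-- … and symmetrically `prodHomeomorphL2⁻¹ = ρ(1) ∘ prodHomeomorph⁻¹`. [cite: LangeBirkenhake1992, §5.3] -/
theorem prodHomeomorphL2_symm_eq_comp [DecidableEq ι₁] [DecidableEq ι₂] :
    ((prodHomeomorphL2 Φ₁ Φ₂).symm : ComplexTorus Φ₁ × ComplexTorus Φ₂ → ComplexTorus (prodPeriodL2 Φ₁ Φ₂)) =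
      mapMatrix (prodPeriod Φ₁ Φ₂) (prodPeriodL2 Φ₁ Φ₂) (1 : Matrix (ι₁ ⊕ ι₂) (ι₁ ⊕ ι₂) ℤ) ∘
        (prodHomeomorph Φ₁ Φ₂).symm := by
  funext p
  rw [comp_apply, mapMatrix_one_eq]
  rfl

/-- **The Euclidean product torus is biholomorphic to the product of the tori** (forward direction;
models `𝓘(ℂ, WithLp 2 (E₁ × E₂))` and `𝓘(ℂ, E₁).prod 𝓘(ℂ, E₂)`). [cite: Lange2023AbelianVarietiesComplex, §1.1] -/
theorem contMDiff_prodHomeomorphL2 {n : WithTop ℕ∞} :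
    ContMDiff 𝓘(ℂ, WithLp 2 (E₁ × E₂)) (𝓘(ℂ, E₁).prod 𝓘(ℂ, E₂)) n (prodHomeomorphL2 Φ₁ Φ₂) := by
  classical
  rw [prodHomeomorphL2_eq_comp]
  exact (contMDiff_prodHomeomorph Φ₁ Φ₂).comp (contMDiff_mapMatrix_one_prodPeriodL2_prodPeriod Φ₁ Φ₂)

/-- **The Euclidean product torus is biholomorphic to the product of the tori** (inverse direction).
[cite: Lange2023AbelianVarietiesComplex, §1.1] -/
theorem contMDiff_prodHomeomorphL2_symm {n : WithTop ℕ∞} :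
    ContMDiff (𝓘(ℂ, E₁).prod 𝓘(ℂ, E₂)) 𝓘(ℂ, WithLp 2 (E₁ × E₂)) n (prodHomeomorphL2 Φ₁ Φ₂).symm := by
  classical
  rw [prodHomeomorphL2_symm_eq_comp]
  exact (contMDiff_mapMatrix_one_prodPeriod_prodPeriodL2 Φ₁ Φ₂).comp (contMDiff_prodHomeomorph_symm Φ₁ Φ₂)

/-- The Euclidean product identification is complex-differentiable. [cite: Lange2023AbelianVarietiesComplex, §1.1] -/
theorem mdifferentiable_prodHomeomorphL2 :
    MDifferentiable 𝓘(ℂ, WithLp 2 (E₁ × E₂)) (𝓘(ℂ, E₁).prod 𝓘(ℂ, E₂)) (prodHomeomorphL2 Φ₁ Φ₂) :=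
  (contMDiff_prodHomeomorphL2 Φ₁ Φ₂ (n := 1)).mdifferentiable one_ne_zero

/-- The inverse Euclidean product identification is complex-differentiable.
[cite: Lange2023AbelianVarietiesComplex, §1.1] -/
theorem mdifferentiable_prodHomeomorphL2_symm :
    MDifferentiable (𝓘(ℂ, E₁).prod 𝓘(ℂ, E₂)) 𝓘(ℂ, WithLp 2 (E₁ × E₂)) (prodHomeomorphL2 Φ₁ Φ₂).symm :=
  (contMDiff_prodHomeomorphL2_symm Φ₁ Φ₂ (n := 1)).mdifferentiable one_ne_zero

/-! ### §4 Products of analytic subsets in the Euclidean product torus -/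

/-- **`Z₁ × Z₂` is an analytic subset of the Euclidean product torus** for analytic `Z₁ ⊆ X₁`, `Z₂ ⊆ X₂`.
[cite: Chirka1989, §2.1 item 4] -/
theorem isAnalyticSet_preimage_prodHomeomorphL2_prod {Z₁ : Set (ComplexTorus Φ₁)}
    {Z₂ : Set (ComplexTorus Φ₂)} (h₁ : IsAnalyticSet 𝓘(ℂ, E₁) Z₁) (h₂ : IsAnalyticSet 𝓘(ℂ, E₂) Z₂) :
    IsAnalyticSet 𝓘(ℂ, WithLp 2 (E₁ × E₂)) (prodHomeomorphL2 Φ₁ Φ₂ ⁻¹' (Z₁ ×ˢ Z₂)) :=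
  (h₁.prod h₂).preimage (mdifferentiable_prodHomeomorphL2 Φ₁ Φ₂)

/-- `dim_ℂ WithLp 2 (E₁ × E₂) = dim_ℂ (E₁ × E₂)` (`= dim E₁ + dim E₂`, `Module.finrank_prod`). [folklore] -/
private theorem finrank_withLp_prod : finrank ℂ (WithLp 2 (E₁ × E₂)) = finrank ℂ (E₁ × E₂) :=
  (WithLp.prodContinuousLinearEquiv 2 ℂ E₁ E₂).toLinearEquiv.finrank_eq

section Pure

variable [FiniteDimensional ℂ E₁] [FiniteDimensional ℂ E₂]

/-- **`dim (Z₁ × Z₂) = dim Z₁ + dim Z₂` in the Euclidean product torus**: for analytic subsets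
`Z₁ ⊆ X₁`, `Z₂ ⊆ X₂` of pure dimensions `d₁`, `d₂`, the product `Z₁ × Z₂` is an analytic subset of pure
dimension `d₁ + d₂` of `ComplexTorus (prodPeriodL2 Φ₁ Φ₂)` — so that its analytic cycle class
`analyticCycleClass (prodPeriodL2 Φ₁ Φ₂) e h (hasPureDim_preimage_prodHomeomorphL2_prod Φ₁ Φ₂ h₁ h₂)` (A4) is
defined. [cite: Chirka1989, §3.5 (proof of Prop. 2)] -/
theorem hasPureDim_preimage_prodHomeomorphL2_prod {Z₁ : Set (ComplexTorus Φ₁)}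
    {Z₂ : Set (ComplexTorus Φ₂)} {d₁ d₂ : ℕ} (h₁ : HasPureDim 𝓘(ℂ, E₁) Z₁ d₁)
    (h₂ : HasPureDim 𝓘(ℂ, E₂) Z₂ d₂) :
    HasPureDim 𝓘(ℂ, WithLp 2 (E₁ × E₂)) (prodHomeomorphL2 Φ₁ Φ₂ ⁻¹' (Z₁ ×ˢ Z₂)) (d₁ + d₂) :=
  (h₁.prod h₂).preimage_homeomorph_of_finrank_eq (prodHomeomorphL2 Φ₁ Φ₂)
    (mdifferentiable_prodHomeomorphL2 Φ₁ Φ₂) (mdifferentiable_prodHomeomorphL2_symm Φ₁ Φ₂) finrank_withLp_prod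

/-- `Z₁ × X₂` has pure dimension `dim Z₁ + dim X₂` in the Euclidean product torus.
[cite: Chirka1989, §2.1 item 4, §3.5] -/
theorem hasPureDim_preimage_prodHomeomorphL2_prod_univ {Z₁ : Set (ComplexTorus Φ₁)} {d₁ : ℕ}
    (h₁ : HasPureDim 𝓘(ℂ, E₁) Z₁ d₁) :
    HasPureDim 𝓘(ℂ, WithLp 2 (E₁ × E₂))
      (prodHomeomorphL2 Φ₁ Φ₂ ⁻¹' (Z₁ ×ˢ (univ : Set (ComplexTorus Φ₂)))) (d₁ + finrank ℂ E₂) :=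
  (h₁.prod_univ (I₂ := 𝓘(ℂ, E₂))).preimage_homeomorph_of_finrank_eq (prodHomeomorphL2 Φ₁ Φ₂)
    (mdifferentiable_prodHomeomorphL2 Φ₁ Φ₂) (mdifferentiable_prodHomeomorphL2_symm Φ₁ Φ₂) finrank_withLp_prod

/-- `X₁ × Z₂` has pure dimension `dim X₁ + dim Z₂` in the Euclidean product torus.
[cite: Chirka1989, §2.1 item 4, §3.5] -/
theorem hasPureDim_preimage_prodHomeomorphL2_univ_prod {Z₂ : Set (ComplexTorus Φ₂)} {d₂ : ℕ}
    (h₂ : HasPureDim 𝓘(ℂ, E₂) Z₂ d₂) :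
    HasPureDim 𝓘(ℂ, WithLp 2 (E₁ × E₂))
      (prodHomeomorphL2 Φ₁ Φ₂ ⁻¹' ((univ : Set (ComplexTorus Φ₁)) ×ˢ Z₂)) (finrank ℂ E₁ + d₂) :=
  (h₂.univ_prod (I₁ := 𝓘(ℂ, E₁))).preimage_homeomorph_of_finrank_eq (prodHomeomorphL2 Φ₁ Φ₂)
    (mdifferentiable_prodHomeomorphL2 Φ₁ Φ₂) (mdifferentiable_prodHomeomorphL2_symm Φ₁ Φ₂) finrank_withLp_prod

/-- `Z₁ × {x₂}` has pure dimension `dim Z₁` in the Euclidean product torus.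
[cite: Chirka1989, §2.1 item 4, §3.5] -/
theorem hasPureDim_preimage_prodHomeomorphL2_prod_singleton {Z₁ : Set (ComplexTorus Φ₁)} {d₁ : ℕ}
    (h₁ : HasPureDim 𝓘(ℂ, E₁) Z₁ d₁) (x₂ : ComplexTorus Φ₂) :
    HasPureDim 𝓘(ℂ, WithLp 2 (E₁ × E₂))
      (prodHomeomorphL2 Φ₁ Φ₂ ⁻¹' (Z₁ ×ˢ ({x₂} : Set (ComplexTorus Φ₂)))) d₁ := by
  have h := (h₁.prod (hasPureDim_singleton (M := ComplexTorus Φ₂) x₂)).preimage_homeomorph_of_finrank_eq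
    (prodHomeomorphL2 Φ₁ Φ₂) (mdifferentiable_prodHomeomorphL2 Φ₁ Φ₂)
    (mdifferentiable_prodHomeomorphL2_symm Φ₁ Φ₂) finrank_withLp_prod
  rwa [add_zero] at h

/-- `{x₁} × Z₂` has pure dimension `dim Z₂` in the Euclidean product torus.
[cite: Chirka1989, §2.1 item 4, §3.5] -/
theorem hasPureDim_preimage_prodHomeomorphL2_singleton_prod (x₁ : ComplexTorus Φ₁)
    {Z₂ : Set (ComplexTorus Φ₂)} {d₂ : ℕ} (h₂ : HasPureDim 𝓘(ℂ, E₂) Z₂ d₂) :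
    HasPureDim 𝓘(ℂ, WithLp 2 (E₁ × E₂))
      (prodHomeomorphL2 Φ₁ Φ₂ ⁻¹' (({x₁} : Set (ComplexTorus Φ₁)) ×ˢ Z₂)) d₂ := by
  have h := ((hasPureDim_singleton (M := ComplexTorus Φ₁) x₁).prod h₂).preimage_homeomorph_of_finrank_eq
    (prodHomeomorphL2 Φ₁ Φ₂) (mdifferentiable_prodHomeomorphL2 Φ₁ Φ₂)
    (mdifferentiable_prodHomeomorphL2_symm Φ₁ Φ₂) finrank_withLp_prod
  rwa [zero_add] at h

end Pure

/-! ### §5 The product polarisation in the Euclidean presentation -/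

section Polarisation

variable [DecidableEq ι₁] [DecidableEq ι₂]

/-- **A pair of Riemann forms polarises the Euclidean product**: the product form `p₁^*ω₁ + p₂^*ω₂`, read
on `WithLp 2 (E₁ × E₂)` through `ofLp`, is a Riemann form of `ComplexTorus (prodPeriodL2 Φ₁ Φ₂)` (pull-back
of `IsRiemannForm.prod` along the injective analytic representation `ofLp` of the change of presentation).
[cite: Lange2023AbelianVarietiesComplex, §2.4 Cor. 2.4.24] [cite: LangeBirkenhake1992, §5.3] -/
theorem IsRiemannForm.prodL2 {ω₁ : E₁ [⋀^Fin 2]→L[ℝ] ℝ} {ω₂ : E₂ [⋀^Fin 2]→L[ℝ] ℝ}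
    (h₁ : IsRiemannForm Φ₁ ω₁) (h₂ : IsRiemannForm Φ₂ ω₂) :
    IsRiemannForm (prodPeriodL2 Φ₁ Φ₂)
      (pullbackForm (WithLp.prodContinuousLinearEquiv 2 ℂ E₁ E₂ : WithLp 2 (E₁ × E₂) →L[ℂ] (E₁ × E₂))
        (prodForm ω₁ ω₂)) :=
  IsRiemannForm.pullback (prodPeriodL2 Φ₁ Φ₂) (prodPeriod Φ₁ Φ₂) (A := (1 : Matrix (ι₁ ⊕ ι₂) (ι₁ ⊕ ι₂) ℤ))
    (fun x ↦ by rw [one_map_intCast_mulVec]; rfl) (WithLp.prodContinuousLinearEquiv 2 ℂ E₁ E₂).injective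
    (h₁.prod h₂)

/-- **The Euclidean product of abelian varieties is an abelian variety** (isogenous — by the change of
presentation — to the product `IsAbelianVariety.prod`). [cite: Lange2023AbelianVarietiesComplex, §2.1.1 Prop. 2.1.1, §2.4 Cor. 2.4.24] -/
theorem IsAbelianVariety.prodL2 (h₁ : IsAbelianVariety Φ₁) (h₂ : IsAbelianVariety Φ₂) :
    IsAbelianVariety (prodPeriodL2 Φ₁ Φ₂) :=
  (isIsogeny_one_prodPeriodL2_prodPeriod Φ₁ Φ₂).isAbelianVariety_of_target (prodPeriodL2 Φ₁ Φ₂)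
    (prodPeriod Φ₁ Φ₂) (h₁.prod h₂)

end Polarisation

end ComplexTorus

/-! ### §6 Validation: the analytic cycle class of `Z₁ × Z₂` is defined on the Euclidean product -/

namespace ComplexTorus

variable {ι₁ ι₂ : Type*} [Fintype ι₁] [Fintype ι₂] {E₁ E₂ : Type*} [NormedAddCommGroup E₁]
  [InnerProductSpace ℂ E₁] [FiniteDimensional ℂ E₁] [MeasurableSpace E₁] [BorelSpace E₁]
  [NormedAddCommGroup E₂] [InnerProductSpace ℂ E₂] [FiniteDimensional ℂ E₂] [MeasurableSpace E₂]
  [BorelSpace E₂] (Φ₁ : (ι₁ → ℝ) ≃L[ℝ] E₁) (Φ₂ : (ι₂ → ℝ) ≃L[ℝ] E₂)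

/-- **Validation**: A4's current of integration `ω ↦ ∫_{Z₁ × Z₂} ω` of the product of analytic subsets of
pure dimensions `d₁`, `d₂` is defined on the Euclidean product torus (model `WithLp 2 (E₁ × E₂)`, an inner
product space) and has bidimension `(d₁ + d₂, d₁ + d₂)`: it kills the invariant forms of type `(r, s)`,
`r ≠ s` (an instance of `analyticCyclePeriod_eq_zero_of_isOfTypeAt`).
[cite: VoisinHodgeI2002, §11.1.3 Thm. 11.21 and (11.6)] -/
theorem analyticCyclePeriod_prodL2_eq_zero_of_isOfTypeAt {Z₁ : Set (ComplexTorus Φ₁)}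
    {Z₂ : Set (ComplexTorus Φ₂)} {d₁ d₂ : ℕ} (h₁ : HasPureDim 𝓘(ℂ, E₁) Z₁ d₁)
    (h₂ : HasPureDim 𝓘(ℂ, E₂) Z₂ d₂) {η : WithLp 2 (E₁ × E₂) [⋀^Fin (2 * (d₁ + d₂))]→L[ℝ] ℂ} {r s : ℕ}
    (hη : IsOfTypeAt r s η) (hrs : r ≠ s) :
    analyticCyclePeriod (prodPeriodL2 Φ₁ Φ₂) (hasPureDim_preimage_prodHomeomorphL2_prod Φ₁ Φ₂ h₁ h₂) η = 0 :=
  analyticCyclePeriod_eq_zero_of_isOfTypeAt (prodPeriodL2 Φ₁ Φ₂) _ hη hrs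

end ComplexTorus

end Literature.Geometry.Kaehler
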